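import Literature.MathematicalPhysics.QuantumFieldTheory.Balaban1983to89.B9SectBGpStepAtLetters

/-!
# `Balaban1983to89.B9SectBGpStepAtLettersAn` — [B9] Sect. B, the analytic-extension step of Theorem 3.4 for the G′ family
# PINNED AT THE LETTERS: `AnFrame` + ★ `stepAnalyticPos1_of_anFrame` (sibling of `B9SectBGpStepAtLetters`)

T. Bałaban, *Propagators for lattice gauge theories in a background field*, Commun. Math. Phys. **99** (1985) 389–434
[`Balaban1985BackgroundPropagators`, "B9"].

statement-level skeleton of published theorems with citation tags; proofs where landed; nothing here is a claim about the
Yang–Mills mass gap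

THE PRINTED LOCUS (verbatim).  Theorem 3.4, p. 400: *"There exists a positive constant a₁ such that the operators G′(U),
(Q′(U)G′²(U)Q′*(U))⁻¹, R(U), G(U) extend to configurations U′U for α₁ ≦ a₁ as analytic functions of A."*; p. 402, after (3.64):
*"Each term in the series is an analytic function of A and the series is convergent uniformly in A for α₁ sufficiently small …
hence G′(U′U) is an analytic function of A."*

THE POINT.  In the cell's leaf the analytic extension is an ABSTRACT predicate of the operator layer, `IsAnalyticExt i K U α₁`
(«K(U′U) is analytic in A on the domain (3.37) with radius α₁»).  `B9SectBStepWhole` (v1.3) splits the printed step per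
family (`StepAnalyticPos1`).  THIS FILE frames the G′ half on the letters of `B9SectBGpStepAtLetters.GpFrame`: what the tree's
Sect. B programme supplies is the EXISTENCE of the extension on the whole class (3.37) — at every U′ = e^{iηA} in the class,
`Δ′_a(U′U) = Δ′_a(U) − V′(A)` is invertible and the family's own `G′(U′U)` is its two-sided inverse (`thm34_Gp_uniform` (i) +
`gop_eq` ∘ `mul_law`); the passage «inverse exists for every A in the domain, and is the family's value there ⇒ the family is
analytic in A there» is the instance's reading of its own predicate (finite lattice: `A ↦ Δ′_a(e^{iηA}U)` is entire, the inverse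
is analytic where it exists — cf. `B9Eq386NeumannAnalytic` for the series form), carried as the single field `writeAn`.

HONEST SCOPE.  Hypothesis structure + bookkeeping; `thm34_Gp_uniform` USED BY NAME; no analyticity is proved here (the field
`writeAn` is the instance's); count-neutral; NOT a node discharge; nothing continuum, nothing about the mass gap.  Cell
`pub-ymgap` (HUMAN RULING D-0062), Track A node N06 [B9], N06-ASSIGNMENT row 13 (step 13-An, G′ half), seat `pub-ymgap-dag-n06-c`
(g2), 2026-08-26.
-/

noncomputable section

namespace Literature.MathematicalPhysics.QuantumFieldTheory.Balaban1983to89.B9SectBGpStepAtLettersAn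

open Literature.MathematicalPhysics.QuantumFieldTheory.Balaban1983to89
open Literature.MathematicalPhysics.QuantumFieldTheory.Balaban1983to89.B6RandomWalk (HasMajorant Triangle254 Ineq261)
open Literature.MathematicalPhysics.QuantumFieldTheory.Balaban1983to89.B9Thm34Ext (toB6)
open Literature.MathematicalPhysics.QuantumFieldTheory.Balaban1983to89.B9Eq352DivFormLetters (conj)
open Literature.MathematicalPhysics.QuantumFieldTheory.Balaban1983to89.B9Eq360VprimeLetters (vPrimeConc)
open Literature.MathematicalPhysics.QuantumFieldTheory.Balaban1983to89.B9Thm34SectBUniform (thm34_Gp_uniform)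
open Literature.MathematicalPhysics.QuantumFieldTheory.Balaban1983to89.B9SectBStepWhole (StepPos StepAnalyticPos1)
open Literature.MathematicalPhysics.QuantumFieldTheory.Balaban1983to89.B9SectBGpStepAtLetters (GpFrame)

universe u

variable {I : Type} (d : ℕ) (c35 : ℝ) (geo : I → B9.Geometry) (bg : I → B9.Backgrounds)
  (Gp : ∀ i, B9.KernelFamily (geo i) (bg i))
  {𝔸 : Type u} [NormedRing 𝔸] [NormedAlgebra ℂ 𝔸] [CompleteSpace 𝔸] {ι : Type} [Fintype ι] [DecidableEq ι]
  (b : Module.Basis ι ℝ 𝔸) (κ : Type) [Fintype κ]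
  (S : I → Type) [∀ i, Fintype (S i)] [∀ i, DecidableEq (S i)]
  [∀ i, Fintype (geo i).Site] [∀ i, DecidableEq (geo i).Site] [∀ i, Nonempty (geo i).Site]

/-- **THE LETTERS DICTIONARY FOR THE ANALYTIC EXTENSION OF G′** — `GpFrame` plus ONE field: at a (3.35)-regular U above the
thresholds and 0 < α₁ ≦ aW, if Δ′_a(U′U) is invertible with inverse the family's own G′(U′U) for EVERY U′ in the class (3.37) at
α₁, then the layer's predicate `IsAnalyticExt i (Gp i) U α₁` holds.  A hypothesis structure; nothing asserted.
[cite: Balaban1985BackgroundPropagators, Thm 3.4 p.400 + (3.62)–(3.64) p.402] -/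
structure AnFrame (IsAnalyticExt : ∀ i, B9.KernelFamily (geo i) (bg i) → (bg i).Cfg → ℝ → Prop)
    extends GpFrame c35 geo bg Gp b κ S where
  writeAn : ∀ i (α₀ : ℝ) (U : (bg i).Cfg) (α₁ : ℝ), MInv ≤ (geo i).M → 0 < α₀ → (geo i).M * α₀ ≤ aInv →
    (bg i).Reg335 c35 α₀ U → 0 < α₁ → α₁ ≤ aW →
    (∀ U' : (bg i).Cfg, (bg i).Cplx337 α₁ U U' →
      Δp i ((bg i).mul U' U) * Gop i ((bg i).mul U' U) = 1 ∧ Gop i ((bg i).mul U' U) * Δp i ((bg i).mul U' U) = 1) →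
    IsAnalyticExt i (Gp i) U α₁

variable {d c35 geo bg Gp b κ S}

/-- ★ **THE ANALYTIC-EXTENSION STEP OF SECT. B FOR G′, INHABITED AT THE LETTERS**: every `AnFrame` inhabits
`B9SectBStepWhole.StepAnalyticPos1 d c35 geo bg Gp GA Cinv IsAnalyticExt Gp`.  Proof: `thm34_Gp_uniform` (i) gives, for every U′
in the class at α₁ ≦ a₁, the two-sided inverse of Δ′_a(U) − V′(A) = Δ′_a(U′U) (`mul_law`), which IS the family's G′(U′U)
(`gop_eq`); then `writeAn`.  Thresholds M ≧ MInv, Mα₀ ≦ aInv, α₁ ≦ min(a₁, aW).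
[cite: Balaban1985BackgroundPropagators, Thm 3.4 p.400 + (3.60)–(3.64) p.402] -/
theorem stepAnalyticPos1_of_anFrame {IsAnalyticExt : ∀ i, B9.KernelFamily (geo i) (bg i) → (bg i).Cfg → ℝ → Prop}
    (F : AnFrame c35 geo bg Gp b κ S IsAnalyticExt)
    (GA : ∀ i, B9.KernelFamily (geo i) (bg i)) (Cinv : ∀ i, B9.SiteKernel (geo i) (bg i)) :
    StepAnalyticPos1 d c35 geo bg Gp GA Cinv IsAnalyticExt Gp := by
  intro B₀ δ₀ Bβ Bε Bεβ B₁ δ₁ hB₀ hδ₀ _ _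
  obtain ⟨a₁, ha₁, B, -, H⟩ := thm34_Gp_uniform b κ F.dB δ₀ (F.cR * B₀) F.Cq F.a₀ F.d₀ F.M₂ (F.Λf δ₀)
    (mul_pos F.cR_pos hB₀) F.Cq_nonneg F.a₀_nonneg F.M₂_nonneg hδ₀ (fun α hα => F.Λf_one_le δ₀ α hδ₀ hα) F.hrepr
  refine ⟨F.MInv, min a₁ F.aW, F.aInv, PUnit.unit, F.MInv_pos, lt_min ha₁ F.aW_pos, F.aInv_pos, trivial, ?_⟩
  intro i hM α₀ hα₀ hMa U hU hT α₁ hα₁ ha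
  obtain ⟨hΔG, hGΔ⟩ := F.reg_inv i α₀ U hM hα₀ hMa hU
  obtain ⟨h1, h2, h3, -⟩ := F.read342 i α₀ U B₀ δ₀ hM hα₀ hMa hU hB₀ hδ₀ hT.1.1.1
  refine F.writeAn i α₀ U α₁ hM hα₀ hMa hU hα₁ (le_trans ha (min_le_right _ _)) fun U' hU' => ?_
  obtain ⟨hkF, hsF, h337s, h337F, h337B, hA, hAτ⟩ := F.cplx i α₁ U U' hα₁ hU'
  obtain ⟨hinv1, hinv2, -, -⟩ := H (F.T i) (F.coord i U) (F.blk i) (F.kQ i U) (F.sQ i U) (F.cfun i) (F.w i U)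
    (F.dist_nonneg i) (F.triangle i) (F.dist_self i) (F.dist_comm i) (F.len_pos i) (F.eta_le_len i) (F.eta_pos i)
    (fun α hα hα1 => F.h261 i δ₀ α hδ₀ hα hα1) (fun α hα => F.hST i δ₀ α hδ₀ hα) (F.unitary i U)
    (F.stencilB i) (F.stencilF i) (F.stencil0 i) (F.w_nonneg i U) (F.card_w i U) (F.hkQ i U) (F.hsQ i U) (F.hcfun i)
    hΔG hGΔ h1 h2 h3 α₁ hα₁.le (le_trans ha (min_le_left _ _)) (F.expA i U U') (F.kF i U U') (F.sF i U U')
    hkF hsF h337s h337F h337B hA hAτ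
  have hG := F.gop_eq i ((bg i).mul U' U) _ _ (F.mul_law i α₁ U U' hα₁ hU') hinv1 hinv2
  rw [F.mul_law i α₁ U U' hα₁ hU', hG]
  exact ⟨hinv1, hinv2⟩

end Literature.MathematicalPhysics.QuantumFieldTheory.Balaban1983to89.B9SectBGpStepAtLettersAn
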